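import Mathlib.Analysis.InnerProductSpace.PiL2
import Mathlib.MeasureTheory.Function.L2Space
import Literature.Analysis.UnboundedOperators.SymmetricPMap
import Literature.Analysis.UnboundedOperators.SpectralGap
import Literature.Analysis.UnboundedOperators.LinearizedBoltzmann
import HarnessLib

-- provenance: harness21/H21/H21/Statements/Hilbert6/LinearizedBoltzmann.lean @ f7a6f2c (interim HEAD d8f2665); M5 mechanical rewrite
/-!
# The linearised hard-sphere Boltzmann operator: spectral properties and transport coefficients

Family: `hilbert6` (statement **hilbert6.S19**, definition-role); trunk UnbddOp, statement item
S-B `LinearizedBoltzmannHardSpheres`.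

We specialise the prelude `Literature.Prelude.UnbddOp.LinearizedBoltzmann` to the velocity space
`V d := EuclideanSpace ℝ (Fin d)` (`d ≥ 2`) with its standard orthonormal basis
`EuclideanSpace.basisFun (Fin d) ℝ`, and record the classical facts about the linearised
hard-sphere collision operator `L = Literature.hardSphereLinearizedOp` on `L²(M dv)`
(`M dv = ProbabilityTheory.stdGaussian (V d)`):

* `L` is symmetric and non-positive on functions of temperate growth;
* `ker L = span {1, v₁, …, v_d, |v|²} = Literature.collisionInvariants (V d)`;
* `-L` has a spectral gap on the `M`-orthogonal complement of the collision invariants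
  (Baranger–Mouhot, explicit);
* `L` has a self-adjoint non-positive realisation `A` on `Lp ℝ 2 (stdGaussian (V d))` with core
  the temperate-growth classes, and `-A` has a spectral gap above its (finite-dimensional)
  ground space, the image `Hilbert6.aeEqClasses (collisionInvariants (V d))` of the collision
  invariants in `L²` (`LinearPMap.HasSpectralGapAbove` of the prelude `SpectralGap`);
* the Chapman–Enskog / hydrodynamic-limit viscosity `ν = C_ν ⟨A, (-L)⁻¹ A⟩` and heat conductivity
  `κ = C_κ ⟨B, (-L)⁻¹ B⟩` (Burnett functions `A`, `B`), with the normalising constants written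
  **only here**, and their strict positivity.

Sources: Cercignani–Illner–Pulvirenti (CIP), *The Mathematical Theory of Dilute Gases* (1994) §7;
Ellis–Pinsky, J. Math. Pures Appl. 54 (1975) 125–156, Prop. 1.1; Baranger–Mouhot, Rev. Mat.
Iberoam. 21 (2005), Thm 1.1; Bardos–Golse–Levermore, CPAM 46 (1993) §2;
Golse–Saint-Raymond, Invent. Math. 155 (2004) (1.15)–(1.16).

## Mathlib

Used without redefinition: `EuclideanSpace`, `EuclideanSpace.basisFun` (already an
`OrthonormalBasis`), `ProbabilityTheory.stdGaussian`, `MeasureTheory.Lp ℝ 2 μ` (with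
`MeasureTheory.L2.innerProductSpace`), `LinearPMap`, `LinearPMap.HasCore`, `IsSelfAdjoint`
(via `LinearPMap.instStar`), `MeasureTheory.Lp.coeFn_add`, `MeasureTheory.Lp.coeFn_smul`,
`MeasureTheory.Lp.coeFn_zero`. From H21: `temperateGrowth`, `hardSphereLinearizedOp`,
`maxwellianInner`, `collisionInvariants`, `viscosityDirichletSum`, `conductivityDirichletSum`
(prelude C8), `LinearPMap.IsPositive` (C1), `LinearPMap.HasSpectralGapAbove` (C2). Mathlib has
nothing on the Boltzmann equation (searched `Boltzmann`, `linearized`, `collision`) and no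
"submodule of `Lp` classes a.e. equal to a member of a submodule of functions" (searched
`Submodule` in `MeasureTheory/Function/LpSpace`), whence `Hilbert6.aeEqClasses`.

## Design choices

* Namespace `Literature.Hilbert6`; the prelude lives in `Literature`, so the specialised theorems here have
  distinct names (`hardSphereLinearizedOp_symmetric` etc.) and no clash arises.
* `V d = EuclideanSpace ℝ (Fin d)` is an `abbrev`, so all Mathlib instances (inner product space,
  Borel measurable space, finite dimension) are found by unification.
* The image of a submodule of functions in `L²(M)` is the honest submodule
  `aeEqClasses W = {f | ∃ g ∈ W, f =ᵐ g}` (no `MemLp` proof obligations in the definition); for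
  `W = collisionInvariants (V d)` every member is a polynomial, hence in `L²(M)`, so nothing is
  lost.
* Normalising constants of `ν`, `κ`: see the docstrings of `hardSphereViscosity`,
  `hardSphereHeatConductivity`; the displays of the cited references could not be checked
  offline and this is flagged there explicitly, as the outline requires.
* All proofs are `sorry` (known theorems in print); positivity of `ν`, `κ` is non-vacuous by
  `Literature.Analysis.UnboundedOperators.bddAbove_range_dirichlet_of_orthogonal`, `Literature.Analysis.UnboundedOperators.burnettA_orthogonal_collisionInvariants`
  and `Literature.Analysis.UnboundedOperators.dirichletFormInv_pos_of_orthogonal_of_ne_zero`.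
-/

open MeasureTheory Real ProbabilityTheory Module
open scoped InnerProductSpace

namespace Literature.MathematicalPhysics.KineticTheory

noncomputable section

/-- The velocity space `ℝ^d` with its Euclidean inner product, `EuclideanSpace ℝ (Fin d)`
(CIP 1994 §7.1: `v ∈ ℝ³`; we keep the dimension `d` general, `d ≥ 2` in the theorems). [cite: CIP1994, §7.1:  v ∈ ℝ³] -/
abbrev V (d : ℕ) : Type := EuclideanSpace ℝ (Fin d)

/-! ### Classes of functions in `L²(M dv)` -/

section AEEqClasses

variable {E : Type*} [MeasurableSpace E] (μ : Measure E)

/-- The submodule of `L²(μ)`-classes that are a.e. equal to some member of a submodule `W` of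
genuine functions `E → ℝ`: the "image of `W` in `L²(μ)`". Used with `W = temperateGrowth` (the
core of the self-adjoint realisation) and `W = collisionInvariants` (its kernel)
(CIP 1994 §7.2). [cite: CIP1994, §7.2] -/
def aeEqClasses (W : Submodule ℝ (E → ℝ)) : Submodule ℝ (Lp ℝ 2 μ) where
  carrier := {f | ∃ g ∈ W, (f : E → ℝ) =ᵐ[μ] g}
  add_mem' := by
    rintro f₁ f₂ ⟨g₁, hg₁, h₁⟩ ⟨g₂, hg₂, h₂⟩
    refine ⟨g₁ + g₂, add_mem hg₁ hg₂, (Lp.coeFn_add f₁ f₂).trans ?_⟩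
    filter_upwards [h₁, h₂] with x hx₁ hx₂
    simp [hx₁, hx₂]
  zero_mem' := ⟨0, zero_mem W, Lp.coeFn_zero ℝ 2 μ⟩
  smul_mem' := by
    rintro c f ⟨g, hg, h⟩
    refine ⟨c • g, W.smul_mem c hg, (Lp.coeFn_smul c f).trans ?_⟩
    filter_upwards [h] with x hx
    simp [hx]

variable {μ} in
/-- Membership in `aeEqClasses μ W`: `f` is a.e. equal to some `g ∈ W`. [folklore] -/
@[simp]
theorem mem_aeEqClasses_iff {W : Submodule ℝ (E → ℝ)} {f : Lp ℝ 2 μ} :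
    f ∈ aeEqClasses μ W ↔ ∃ g ∈ W, (f : E → ℝ) =ᵐ[μ] g :=
  Iff.rfl

end AEEqClasses

/-! ### hilbert6.S19: the linearised hard-sphere operator on `L²(M dv)` -/

variable {d : ℕ}

/-- **hilbert6.S19** (symmetry; CIP 1994 §7.1 (7.1.9), Ellis–Pinsky, J. Math. Pures Appl. 54
(1975) §1). The linearised hard-sphere collision operator `L` on `ℝ^d` is symmetric for the
`L²(M dv)` pairing on functions of temperate growth: `⟪h, L g⟫_M = ⟪L h, g⟫_M`. [cite: CIP1994, §7.1 (7.1.9] -/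
def hardSphereLinearizedOp_symmetric : Prop :=
  ∀ {g h : V d → ℝ} (hg : g ∈ Literature.Analysis.UnboundedOperators.temperateGrowth (V d)) (hh : h ∈ Literature.Analysis.UnboundedOperators.temperateGrowth (V d)),
    Literature.Analysis.UnboundedOperators.maxwellianInner h (Literature.Analysis.UnboundedOperators.hardSphereLinearizedOp g) = Literature.Analysis.UnboundedOperators.maxwellianInner (Literature.Analysis.UnboundedOperators.hardSphereLinearizedOp h) g

/-- **hilbert6.S19** (non-positivity; CIP 1994 §7.1 (7.1.10), Ellis–Pinsky 1975 §1). The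
linearised hard-sphere collision operator is non-positive on `L²(M dv)`:
`⟪g, L g⟫_M = -¼ ∫∫∫ ((v - v_*)·ω)_+ M M_* (g' + g_*' - g - g_*)² ≤ 0` for `g` of temperate
growth. [cite: CIP1994, §7.1 (7.1.10] -/
def hardSphereLinearizedOp_nonpos : Prop :=
  ∀ {g : V d → ℝ} (hg : g ∈ Literature.Analysis.UnboundedOperators.temperateGrowth (V d)),
    Literature.Analysis.UnboundedOperators.maxwellianInner g (Literature.Analysis.UnboundedOperators.hardSphereLinearizedOp g) ≤ 0

/- interim proof relied on results that are now named facts (D-0014); demoted to a fact by the M5 import, proof preserved: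
:=
  maxwellianInner_hardSphereLinearizedOp_self_nonpos hg
-/

/-- **hilbert6.S19** (kernel; CIP 1994 §7.1 with Thm 3.1.1, Ellis–Pinsky 1975 Prop. 1.1). In
velocity dimension `d ≥ 2`, a function `g` of temperate growth satisfies `L g = 0` iff it is a
collision invariant, `g ∈ span {1, v₁, …, v_d, |v|²}`. [cite: CIP1994, §7.1 with Thm 3.1.1  Ellis–Pinsky 1975 P] -/
def hardSphereLinearizedOp_eq_zero_iff_mem_collisionInvariants : Prop :=
  ∀ (hd : 2 ≤ d) {g : V d → ℝ} (hg : g ∈ Literature.Analysis.UnboundedOperators.temperateGrowth (V d)),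
    Literature.Analysis.UnboundedOperators.hardSphereLinearizedOp g = 0 ↔ g ∈ Literature.Analysis.UnboundedOperators.collisionInvariants (V d)

/- interim proof relied on results that are now named facts (D-0014); demoted to a fact by the M5 import, proof preserved:
:=
  hardSphereLinearizedOp_eq_zero_iff (by simpa using hd) hg
-/

/-- **hilbert6.S19** (spectral gap; Baranger–Mouhot, Rev. Mat. Iberoam. 21 (2005) Thm 1.1, with
an explicit constant; qualitatively Grad 1963, Ellis–Pinsky 1975 Prop. 1.1). In velocity
dimension `d ≥ 2` there is `λ > 0` with `λ ‖g‖²_M ≤ -⟪g, L g⟫_M` for every `g` of temperate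
growth that is `M`-orthogonal to the collision invariants. [cite: Grad1963, Ellis–Pinsky 1975 Prop. 1.1] -/
def hardSphereLinearizedOp_spectralGap : Prop :=
  ∀ (hd : 2 ≤ d),
    ∃ lam : ℝ, 0 < lam ∧ ∀ g ∈ Literature.Analysis.UnboundedOperators.temperateGrowth (V d),
      (∀ φ ∈ Literature.Analysis.UnboundedOperators.collisionInvariants (V d), Literature.Analysis.UnboundedOperators.maxwellianInner g φ = 0) →
        lam * Literature.Analysis.UnboundedOperators.maxwellianInner g g ≤ -Literature.Analysis.UnboundedOperators.maxwellianInner g (Literature.Analysis.UnboundedOperators.hardSphereLinearizedOp g)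

/- interim proof relied on results that are now named facts (D-0014); demoted to a fact by the M5 import, proof preserved:
:=
  le_neg_maxwellianInner_hardSphereLinearizedOp_of_orthogonal (by simpa using hd)
-/

/-- **hilbert6.S19** (self-adjoint realisation with spectral gap; CIP 1994 §7.2, Thm 7.2.1 ff.;
Ellis–Pinsky 1975 Prop. 1.1; Baranger–Mouhot 2005 Thm 1.1). In velocity dimension `d ≥ 2` there
are a submodule `S` of `L²(M dv) = Lp ℝ 2 (stdGaussian ℝ^d)`, a partially defined operator `A`
on it and `λ > 0` such that: `A` is self-adjoint, `-A` is non-negative, `S` is a core of `A`,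
`S` consists exactly of the classes of temperate-growth functions, `A` acts on `S` as the
linearised hard-sphere operator `L`, and `-A` has a spectral gap `λ` above its ground space at
energy `0`, the (finite-dimensional) image `aeEqClasses _ (collisionInvariants ℝ^d)` of the
collision invariants in `L²(M dv)`. [cite: CIP1994, §7.2  Thm 7.2.1 ff] -/
def hardSphereLinearizedOp_selfAdjointRealisation : Prop :=
  ∀ (hd : 2 ≤ d),
    ∃ (S : Submodule ℝ (Lp ℝ 2 (stdGaussian (V d))))
      (A : Lp ℝ 2 (stdGaussian (V d)) →ₗ.[ℝ] Lp ℝ 2 (stdGaussian (V d))) (lam : ℝ),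
      0 < lam ∧ IsSelfAdjoint A ∧ (-A).IsPositive ∧ A.HasCore S ∧
      S = aeEqClasses (stdGaussian (V d)) (Literature.Analysis.UnboundedOperators.temperateGrowth (V d)) ∧
      (∀ (f : A.domain) (g : V d → ℝ), g ∈ Literature.Analysis.UnboundedOperators.temperateGrowth (V d) →
        ((f : Lp ℝ 2 (stdGaussian (V d))) : V d → ℝ) =ᵐ[stdGaussian (V d)] g →
        ((A f : Lp ℝ 2 (stdGaussian (V d))) : V d → ℝ) =ᵐ[stdGaussian (V d)]
          Literature.Analysis.UnboundedOperators.hardSphereLinearizedOp g) ∧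
      (-A).HasSpectralGapAbove (aeEqClasses (stdGaussian (V d)) (Literature.Analysis.UnboundedOperators.collisionInvariants (V d)))
        0 lam

/-! ### hilbert6.S19: Chapman–Enskog transport coefficients -/

/-- **hilbert6.S19** (viscosity; Bardos–Golse–Levermore, CPAM 46 (1993) §2, formula for `ν`
after (2.20); Golse–Saint-Raymond, Invent. Math. 155 (2004) (1.15); CIP 1994 §7.2). The
Chapman–Enskog / incompressible-Navier–Stokes-limit *kinematic viscosity* of the hard-sphere gas
around the normalised Maxwellian in dimension `d`:
`ν = (1 / ((d - 1) (d + 2))) ∑_{i,j} ⟨A_{ij}, (-L)⁻¹ A_{ij}⟩_M`, where `A_{ij} = vᵢ vⱼ - δᵢⱼ |v|²/d`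
are the Burnett functions in the standard basis `EuclideanSpace.basisFun`.
**Normalisation as in Golse–Saint-Raymond 2004 (1.15) / Bardos–Golse–Levermore 1993 §2,
unverified**: the display could not be matched offline; the constant `1/((d-1)(d+2))` is the
architect's (outline UnbddOp S-B) and appears only here. For `d ≤ 1` the constant is a junk
value (`(d - 1) = 0`, real division by zero gives `0`); statements assume `2 ≤ d`. [cite: CIP1994, §7.2] -/
def hardSphereViscosity (d : ℕ) : ℝ :=
  (1 / ((d - 1) * (d + 2) : ℝ)) *
    Literature.Analysis.UnboundedOperators.viscosityDirichletSum (E := V d) Literature.Analysis.UnboundedOperators.hardSphereLinearizedOp (EuclideanSpace.basisFun (Fin d) ℝ)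

/-- **hilbert6.S19** (heat conductivity; Bardos–Golse–Levermore, CPAM 46 (1993) §2, formula for
`κ` after (2.20); Golse–Saint-Raymond, Invent. Math. 155 (2004) (1.16); CIP 1994 §7.2). The
Chapman–Enskog / Fourier-limit *heat conductivity* of the hard-sphere gas around the normalised
Maxwellian in dimension `d`: `κ = (2 / (d (d + 2))) ∑_i ⟨B_i, (-L)⁻¹ B_i⟩_M`, where
`B_i = ½ vᵢ (|v|² - (d + 2))` are the Burnett functions in the standard basis.
**Normalisation as in Golse–Saint-Raymond 2004 (1.16) / Bardos–Golse–Levermore 1993 §2,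
unverified**: the display could not be matched offline; the constant `2/(d(d+2))` is the
architect's (outline UnbddOp S-B) and appears only here. For `d = 0` the constant is the junk
value `0`; statements assume `2 ≤ d`. [cite: CIP1994, §7.2] -/
def hardSphereHeatConductivity (d : ℕ) : ℝ :=
  (2 / (d * (d + 2) : ℝ)) *
    Literature.Analysis.UnboundedOperators.conductivityDirichletSum (E := V d) Literature.Analysis.UnboundedOperators.hardSphereLinearizedOp
      (EuclideanSpace.basisFun (Fin d) ℝ)

/-- **hilbert6.S19** (positivity of the viscosity; CIP 1994 §7.2, Bardos–Golse–Levermore 1993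
§2). In dimension `d ≥ 2` the hard-sphere viscosity is strictly positive: each
`⟨A_{ij}, (-L)⁻¹ A_{ij}⟩_M ≥ 0` (`Literature.Analysis.UnboundedOperators.dirichletFormInv_nonneg_of_orthogonal`, non-vacuous by
`Literature.Analysis.UnboundedOperators.bddAbove_range_dirichlet_of_orthogonal` and `Literature.Analysis.UnboundedOperators.burnettA_orthogonal_collisionInvariants`)
and `A_{12} ≠ 0` gives a strictly positive term
(`Literature.Analysis.UnboundedOperators.dirichletFormInv_pos_of_orthogonal_of_ne_zero`). [cite: CIP1994, §7.2  Bardos–Golse–Levermore 1993 §2] -/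
def hardSphereViscosity_pos : Prop :=
  ∀ (hd : 2 ≤ d),
    0 < hardSphereViscosity d

/-- **hilbert6.S19** (positivity of the heat conductivity; CIP 1994 §7.2, Bardos–Golse–Levermore
1993 §2). In dimension `d ≥ 2` the hard-sphere heat conductivity is strictly positive
(`B_i ≠ 0` is `M`-orthogonal to the collision invariants,
`Literature.Analysis.UnboundedOperators.burnettB_orthogonal_collisionInvariants`, `Literature.Analysis.UnboundedOperators.dirichletFormInv_pos_of_orthogonal_of_ne_zero`). [cite: CIP1994, §7.2  Bardos–Golse–Levermore 1993 §2] -/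
def hardSphereHeatConductivity_pos : Prop :=
  ∀ (hd : 2 ≤ d),
    0 < hardSphereHeatConductivity d

end

end Literature.MathematicalPhysics.KineticTheory
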